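import Mathlib.Analysis.InnerProductSpace.PiL2
import Mathlib.Analysis.InnerProductSpace.LinearMap
import Mathlib.Analysis.Calculus.MeanValue
import Mathlib.Analysis.Calculus.FDeriv.Symmetric
import Mathlib.Analysis.Calculus.ContDiff.Operations
import Mathlib.Analysis.SpecialFunctions.Pow.Deriv
import Mathlib.LinearAlgebra.FiniteDimensional.Lemmas
import Literature.Geometry.Lorentzian.ChartCalculus
import HarnessLib

/-!
# Rigidity of the transition between two asymptotically flat structures at infinity

Support file (all results proved) for Bartnik's uniqueness theorem for the ADM energy
(`AFEnd.HasADMEnergy.Of_isSameEnd`; Bartnik, CPAM 39 (1986), Cor. 3.2 and Thm. 4.2). On a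
finite-dimensional real inner product space `E` let `h`, `h'` be the components of one metric in
two charts related by the transition map `x = G(y)`, i.e. the **tensor transformation law**
`h'(y)(v, w) = h(G y)(DG(y) v, DG(y) w)`, with `h − δ = O₁(r^{−α})` and `h' − δ = O₁(r^{−α})`.
Bartnik (Cor. 3.2, via harmonic coordinates) and Chruściel (1986, §2, elementary) prove that `G`
is asymptotic to a rigid motion: `DG → O ∈ O(E)` with `DG − O = O(r^{−α})`, `D²G = O(r^{−1−α})`.
This file gives Chruściel's elementary argument:

* pointwise algebra at one point (`norm_map_le`, `norm_le_two_mul_norm_map`,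
  `abs_inner_map_map_sub_inner_le`): `‖DG‖ ≤ 2`, `‖v‖ ≤ 2‖DG v‖`, `⟪DGv, DGw⟫ − ⟪v, w⟫` small;
* the differentiated law (`fderiv_law_apply`) and the **Christoffel trick**
  (`norm_snd_le_of_law`): a trilinear form symmetric in two slots is determined by its
  symmetrisation in the other pair, whence `‖D²G(y)‖ ≤ 6 (‖Dh'(y)‖ + 8 ‖Dh(G y)‖)`;
* radial integration (`norm_sub_smul_le_of_norm_fderiv_le`, `exists_limit_of_norm_fderiv_le`,
  `norm_le_of_norm_fderiv_le_rpow`): a map with `‖Df(z)‖ ≤ C‖z‖^{−1−α}` on `{R ≤ ‖z‖}`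
  (`dim E ≥ 2`) has a limit `L` at infinity with `‖f(y) − L‖ ≤ (C/α)‖y‖^{−α}`, and a map with
  `‖Df(z)‖ ≤ C‖z‖^{−α}`, `α < 1`, grows at most like `‖y‖^{1−α}`.

The assembled rigidity statement for end structures is in `ADMTransitionRigidityEnd`.

## References

* R. Bartnik, *The mass of an asymptotically flat manifold*, CPAM 39 (1986), §3, Cor. 3.2.
* P. T. Chruściel, *Boundary conditions at spatial infinity from a Hamiltonian point of view*,
  in: Topological properties and global structure of space-time (1986), §2, Prop. 2.1.
-/

noncomputable section

-- instance search on the nested operator spaces `E →L[ℝ] E →L[ℝ] E →L[ℝ] ℝ` is deep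
set_option maxSynthPendingDepth 3

open Set Filter Metric ContinuousLinearMap
open scoped Topology RealInnerProductSpace ContDiff

namespace Literature.Geometry.Lorentzian

namespace TransitionRigidity

variable {E : Type*} [NormedAddCommGroup E] [InnerProductSpace ℝ E]

/-! ### Bilinear forms close to the Euclidean one -/

/-- `|B(v, w) − ⟪v, w⟫| ≤ ‖B − δ‖ ‖v‖ ‖w‖`. [folklore] -/
theorem abs_apply_sub_inner_le (B : E →L[ℝ] E →L[ℝ] ℝ) (v w : E) :
    |B v w - ⟪v, w⟫| ≤ ‖B - innerSL ℝ‖ * ‖v‖ * ‖w‖ := by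
  have h := (B - innerSL ℝ).le_opNorm₂ v w
  rwa [_root_.sub_apply, _root_.sub_apply, innerSL_apply_apply, Real.norm_eq_abs] at h

/-- If `‖B − δ‖ ≤ 1/2` then `‖v‖² ≤ 2 B(v, v)`. [folklore] -/
theorem norm_sq_le_two_mul_apply {B : E →L[ℝ] E →L[ℝ] ℝ} (hB : ‖B - innerSL ℝ‖ ≤ 1 / 2) (v : E) :
    ‖v‖ ^ 2 ≤ 2 * B v v := by
  have h := abs_apply_sub_inner_le B v v
  rw [real_inner_self_eq_norm_sq] at h
  have h' : |B v v - ‖v‖ ^ 2| ≤ 1 / 2 * ‖v‖ * ‖v‖ :=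
    h.trans (by gcongr)
  nlinarith [abs_le.1 h', norm_nonneg v]

/-- If `‖B − δ‖ ≤ 1/2` then `B(v, v) ≤ (3/2) ‖v‖²`. [folklore] -/
theorem apply_le_norm_sq {B : E →L[ℝ] E →L[ℝ] ℝ} (hB : ‖B - innerSL ℝ‖ ≤ 1 / 2) (v : E) :
    B v v ≤ 3 / 2 * ‖v‖ ^ 2 := by
  have h := abs_apply_sub_inner_le B v v
  rw [real_inner_self_eq_norm_sq] at h
  have h' : |B v v - ‖v‖ ^ 2| ≤ 1 / 2 * ‖v‖ * ‖v‖ :=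
    h.trans (by gcongr)
  nlinarith [abs_le.1 h', norm_nonneg v]

/-! ### Pointwise consequences of the tensor transformation law -/

section Pointwise

variable {h₀ h₀' : E →L[ℝ] E →L[ℝ] ℝ} {P : E →L[ℝ] E}

/-- **`‖DG‖ ≤ 2`**: if `h'(v, w) = h(Pv, Pw)` with `h`, `h'` both `1/2`-close to `δ`, then
`‖P v‖ ≤ 2‖v‖` (`‖Pv‖² ≤ 2h(Pv,Pv) = 2h'(v,v) ≤ 3‖v‖²`). Chruściel 1986, §2. [cite: Bartnik1986, §3, Cor. 3.2] -/
theorem norm_map_le (hB : ‖h₀ - innerSL ℝ‖ ≤ 1 / 2) (hB' : ‖h₀' - innerSL ℝ‖ ≤ 1 / 2)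
    (hlaw : ∀ v w, h₀' v w = h₀ (P v) (P w)) (v : E) : ‖P v‖ ≤ 2 * ‖v‖ := by
  have h1 := norm_sq_le_two_mul_apply hB (P v)
  have h2 := apply_le_norm_sq hB' v
  rw [hlaw] at h2
  have h3 : ‖P v‖ ^ 2 ≤ (2 * ‖v‖) ^ 2 := by nlinarith
  exact (pow_le_pow_iff_left₀ (norm_nonneg _) (by positivity) two_ne_zero).1 h3

/-- The operator norm version: `‖P‖ ≤ 2`. [folklore] -/
theorem opNorm_map_le (hB : ‖h₀ - innerSL ℝ‖ ≤ 1 / 2) (hB' : ‖h₀' - innerSL ℝ‖ ≤ 1 / 2)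
    (hlaw : ∀ v w, h₀' v w = h₀ (P v) (P w)) : ‖P‖ ≤ 2 :=
  opNorm_le_bound _ (by norm_num) (norm_map_le hB hB' hlaw)

/-- **`DG` is uniformly injective**: `‖v‖ ≤ 2‖P v‖` (`‖v‖² ≤ 2h'(v,v) = 2h(Pv,Pv) ≤ 3‖Pv‖²`).
Chruściel 1986, §2. [cite: Bartnik1986, §3, Cor. 3.2] -/
theorem norm_le_two_mul_norm_map (hB : ‖h₀ - innerSL ℝ‖ ≤ 1 / 2) (hB' : ‖h₀' - innerSL ℝ‖ ≤ 1 / 2)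
    (hlaw : ∀ v w, h₀' v w = h₀ (P v) (P w)) (v : E) : ‖v‖ ≤ 2 * ‖P v‖ := by
  have h1 := norm_sq_le_two_mul_apply hB' v
  have h2 := apply_le_norm_sq hB (P v)
  rw [hlaw] at h1
  have h3 : ‖v‖ ^ 2 ≤ (2 * ‖P v‖) ^ 2 := by nlinarith
  exact (pow_le_pow_iff_left₀ (norm_nonneg _) (by positivity) two_ne_zero).1 h3

/-- `DG` is bijective (injective by the previous estimate, hence surjective in finite
dimension). [folklore] -/
theorem surjective_map [FiniteDimensional ℝ E] (hB : ‖h₀ - innerSL ℝ‖ ≤ 1 / 2)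
    (hB' : ‖h₀' - innerSL ℝ‖ ≤ 1 / 2) (hlaw : ∀ v w, h₀' v w = h₀ (P v) (P w)) :
    Function.Surjective P := by
  have hinj : Function.Injective P := by
    intro v w hvw
    have h := norm_le_two_mul_norm_map hB hB' hlaw (v - w)
    rw [map_sub, hvw, sub_self, norm_zero, mul_zero] at h
    exact sub_eq_zero.1 (norm_le_zero_iff.1 h)
  exact LinearMap.surjective_of_injective (f := (P : E →ₗ[ℝ] E)) hinj

/-- **`DG` is almost orthogonal**: `|⟪Pv, Pw⟫ − ⟪v, w⟫| ≤ (4‖h − δ‖ + ‖h' − δ‖) ‖v‖ ‖w‖`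
(`⟪Pv,Pw⟫ ≈ h(Pv,Pw) = h'(v,w) ≈ ⟪v,w⟫`). Bartnik 1986, (3.5): `gᵀ(DG)ᵀ(DG) − δ ∈ W_{−τ}`.
[cite: Bartnik1986, §3, (3.5)] -/
theorem abs_inner_map_map_sub_inner_le (hB : ‖h₀ - innerSL ℝ‖ ≤ 1 / 2)
    (hB' : ‖h₀' - innerSL ℝ‖ ≤ 1 / 2) (hlaw : ∀ v w, h₀' v w = h₀ (P v) (P w)) (v w : E) :
    |⟪P v, P w⟫ - ⟪v, w⟫| ≤ (4 * ‖h₀ - innerSL ℝ‖ + ‖h₀' - innerSL ℝ‖) * ‖v‖ * ‖w‖ := by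
  have h1 := abs_apply_sub_inner_le h₀ (P v) (P w)
  have h2 := abs_apply_sub_inner_le h₀' v w
  rw [hlaw] at h2
  have hv := norm_map_le hB hB' hlaw v
  have hw := norm_map_le hB hB' hlaw w
  have h3 : ‖h₀ - innerSL ℝ‖ * ‖P v‖ * ‖P w‖ ≤ ‖h₀ - innerSL ℝ‖ * (2 * ‖v‖) * (2 * ‖w‖) := by
    gcongr
  calc |⟪P v, P w⟫ - ⟪v, w⟫|
      = |(h₀ (P v) (P w) - ⟪v, w⟫) - (h₀ (P v) (P w) - ⟪P v, P w⟫)| := by ring_nf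
    _ ≤ |h₀ (P v) (P w) - ⟪v, w⟫| + |h₀ (P v) (P w) - ⟪P v, P w⟫| := abs_sub _ _
    _ ≤ ‖h₀' - innerSL ℝ‖ * ‖v‖ * ‖w‖ + ‖h₀ - innerSL ℝ‖ * (2 * ‖v‖) * (2 * ‖w‖) :=
        add_le_add h2 (h1.trans h3)
    _ = (4 * ‖h₀ - innerSL ℝ‖ + ‖h₀' - innerSL ℝ‖) * ‖v‖ * ‖w‖ := by ring

/-- **The Christoffel trick** (bound on `D²G`). Suppose `h'(v,w) = h(Pv,Pw)` as above, `h`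
symmetric, and the differentiated law
`τ'(u,v,w) = τ(Pu,Pv,Pw) + h(S(u,v), Pw) + h(Pv, S(u,w))` holds with `S` symmetric (here
`τ = Dh(Gy)`, `τ' = Dh'(y)`, `S = D²G(y)`). Then `‖S‖ ≤ 6 (‖τ'‖ + 8‖τ‖)`: the form
`T(u,v,w) = h(S(u,v), Pw)` is symmetric in `(u,v)` and its symmetrisation in `(v,w)` is known, so
`2T(u,v,w) = A(u,v,w) + A(v,u,w) − A(w,u,v)`; then test with `Pw = S(u,v)`. This is the classical
computation `∂²y/∂x∂x = Γ' ∂y − Γ(∂y, ∂y)`, Chruściel 1986, §2; Bartnik 1986, (3.5)–(3.6).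
[cite: Bartnik1986, §3, Cor. 3.2] -/
theorem norm_snd_le_of_law [FiniteDimensional ℝ E] (hB : ‖h₀ - innerSL ℝ‖ ≤ 1 / 2)
    (hB' : ‖h₀' - innerSL ℝ‖ ≤ 1 / 2) (hlaw : ∀ v w, h₀' v w = h₀ (P v) (P w))
    (hsym : ∀ a c, h₀ a c = h₀ c a) {S : E →L[ℝ] E →L[ℝ] E} (hS : ∀ u v, S u v = S v u)
    {τ τ' : E →L[ℝ] E →L[ℝ] E →L[ℝ] ℝ}
    (hdlaw : ∀ u v w, τ' u v w = τ (P u) (P v) (P w) + h₀ (S u v) (P w) + h₀ (P v) (S u w)) :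
    ‖S‖ ≤ 6 * (‖τ'‖ + 8 * ‖τ‖) := by
  set M : ℝ := ‖τ'‖ + 8 * ‖τ‖ with hM
  have hM0 : 0 ≤ M := by positivity
  have hPle := norm_map_le hB hB' hlaw
  -- the known symmetrisation `A(u,v,w) = T(u,v,w) + T(u,w,v)`
  have hA : ∀ u v w, |h₀ (S u v) (P w) + h₀ (S u w) (P v)| ≤ M * ‖u‖ * ‖v‖ * ‖w‖ := by
    intro u v w
    have heq : h₀ (S u v) (P w) + h₀ (S u w) (P v) = τ' u v w - τ (P u) (P v) (P w) := by
      rw [hdlaw u v w, hsym (P v) (S u w)]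
      ring
    rw [heq]
    have h1 : |τ' u v w| ≤ ‖τ'‖ * ‖u‖ * ‖v‖ * ‖w‖ := by
      rw [← Real.norm_eq_abs]
      calc ‖τ' u v w‖ ≤ ‖τ' u v‖ * ‖w‖ := le_opNorm _ _
        _ ≤ ‖τ' u‖ * ‖v‖ * ‖w‖ := by gcongr; exact le_opNorm _ _
        _ ≤ ‖τ'‖ * ‖u‖ * ‖v‖ * ‖w‖ := by gcongr; exact le_opNorm _ _
    have h2 : |τ (P u) (P v) (P w)| ≤ ‖τ‖ * (2 * ‖u‖) * (2 * ‖v‖) * (2 * ‖w‖) := by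
      rw [← Real.norm_eq_abs]
      calc ‖τ (P u) (P v) (P w)‖ ≤ ‖τ (P u) (P v)‖ * ‖P w‖ := le_opNorm _ _
        _ ≤ ‖τ (P u)‖ * ‖P v‖ * ‖P w‖ := by gcongr; exact le_opNorm _ _
        _ ≤ ‖τ‖ * ‖P u‖ * ‖P v‖ * ‖P w‖ := by gcongr; exact le_opNorm _ _
        _ ≤ ‖τ‖ * (2 * ‖u‖) * (2 * ‖v‖) * (2 * ‖w‖) := by gcongr <;> exact hPle _
    calc |τ' u v w - τ (P u) (P v) (P w)| ≤ |τ' u v w| + |τ (P u) (P v) (P w)| := abs_sub _ _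
      _ ≤ ‖τ'‖ * ‖u‖ * ‖v‖ * ‖w‖ + ‖τ‖ * (2 * ‖u‖) * (2 * ‖v‖) * (2 * ‖w‖) := add_le_add h1 h2
      _ = M * ‖u‖ * ‖v‖ * ‖w‖ := by rw [hM]; ring
  -- hence `T` itself is bounded
  have hT : ∀ u v w, |h₀ (S u v) (P w)| ≤ 3 / 2 * M * ‖u‖ * ‖v‖ * ‖w‖ := by
    intro u v w
    have e1 := hA u v w
    have e2 := hA v u w
    have e3 := hA w u v
    rw [hS v u] at e2
    rw [hS w u, hS w v] at e3
    have key : 2 * h₀ (S u v) (P w) = (h₀ (S u v) (P w) + h₀ (S u w) (P v)) +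
        (h₀ (S u v) (P w) + h₀ (S v w) (P u)) - (h₀ (S u w) (P v) + h₀ (S v w) (P u)) := by ring
    have : |2 * h₀ (S u v) (P w)| ≤ 3 * (M * ‖u‖ * ‖v‖ * ‖w‖) := by
      rw [key]
      calc _ ≤ |h₀ (S u v) (P w) + h₀ (S u w) (P v) + (h₀ (S u v) (P w) + h₀ (S v w) (P u))| +
            |h₀ (S u w) (P v) + h₀ (S v w) (P u)| := abs_sub _ _
        _ ≤ (|h₀ (S u v) (P w) + h₀ (S u w) (P v)| + |h₀ (S u v) (P w) + h₀ (S v w) (P u)|) +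
            |h₀ (S u w) (P v) + h₀ (S v w) (P u)| := by gcongr; exact abs_add_le _ _
        _ ≤ (M * ‖u‖ * ‖v‖ * ‖w‖ + M * ‖v‖ * ‖u‖ * ‖w‖) + M * ‖w‖ * ‖u‖ * ‖v‖ :=
            add_le_add (add_le_add e1 e2) e3
        _ = 3 * (M * ‖u‖ * ‖v‖ * ‖w‖) := by ring
    rw [abs_mul, abs_two] at this
    linarith
  -- test with `P w = S u v`
  refine opNorm_le_bound₂ _ (by positivity) fun u v ↦ ?_
  obtain ⟨w, hw⟩ := surjective_map hB hB' hlaw (S u v)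
  have hwn : ‖w‖ ≤ 2 * ‖S u v‖ := by
    have := norm_le_two_mul_norm_map hB hB' hlaw w
    rwa [hw] at this
  have h1 : ‖S u v‖ ^ 2 ≤ 2 * h₀ (S u v) (S u v) := norm_sq_le_two_mul_apply hB _
  have h2 : h₀ (S u v) (S u v) ≤ 3 / 2 * M * ‖u‖ * ‖v‖ * ‖w‖ := by
    have := hT u v w
    rw [hw] at this
    exact (le_abs_self _).trans this
  have h3 : ‖S u v‖ ^ 2 ≤ (6 * M * ‖u‖ * ‖v‖) * ‖S u v‖ := by
    have : 3 / 2 * M * ‖u‖ * ‖v‖ * ‖w‖ ≤ 3 / 2 * M * ‖u‖ * ‖v‖ * (2 * ‖S u v‖) := by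
      gcongr
    nlinarith
  by_cases h0 : ‖S u v‖ = 0
  · rw [h0]; positivity
  · have hpos : 0 < ‖S u v‖ := lt_of_le_of_ne (norm_nonneg _) (Ne.symm h0)
    calc ‖S u v‖ = ‖S u v‖ ^ 2 / ‖S u v‖ := by rw [sq, mul_div_cancel_right₀ _ h0]
      _ ≤ (6 * M * ‖u‖ * ‖v‖) * ‖S u v‖ / ‖S u v‖ := by gcongr
      _ = 6 * M * ‖u‖ * ‖v‖ := mul_div_cancel_right₀ _ h0
      _ = 6 * (‖τ'‖ + 8 * ‖τ‖) * ‖u‖ * ‖v‖ := by rw [hM]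

end Pointwise

/-! ### The differentiated transformation law -/

/-- **Differentiating the tensor transformation law.** If `h'(z)(v,w) = h(G z)(DG(z)v, DG(z)w)`
near `y`, `G` is `C²` at `y`, `h` is differentiable at `G y` and `h'` at `y`, then
`Dh'(y)(u,v,w) = Dh(Gy)(DG u, DG v, DG w) + h(Gy)(D²G(u,v), DG w) + h(Gy)(DG v, D²G(u,w))`
(product and chain rules). Bartnik 1986, (3.5)–(3.6); Chruściel 1986, §2. [cite: Bartnik1986, §3, (3.5)–(3.6)] -/
theorem fderiv_law_apply {h h' : E → E →L[ℝ] E →L[ℝ] ℝ} {G : E → E} {y : E}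
    (hlaw : ∀ᶠ z in 𝓝 y, ∀ v w, h' z v w = h (G z) (fderiv ℝ G z v) (fderiv ℝ G z w))
    (hG : ContDiffAt ℝ 2 G y) (hh : DifferentiableAt ℝ h (G y)) (hh' : DifferentiableAt ℝ h' y)
    (u v w : E) :
    fderiv ℝ h' y u v w =
      fderiv ℝ h (G y) (fderiv ℝ G y u) (fderiv ℝ G y v) (fderiv ℝ G y w)
        + h (G y) (fderiv ℝ (fderiv ℝ G) y u v) (fderiv ℝ G y w)
        + h (G y) (fderiv ℝ G y v) (fderiv ℝ (fderiv ℝ G) y u w) := by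
  have hGd : DifferentiableAt ℝ G y := hG.differentiableAt (by norm_num)
  have hP : HasFDerivAt (fun z ↦ fderiv ℝ G z) (fderiv ℝ (fderiv ℝ G) y) y :=
    ((hG.fderiv_right (m := 1) le_rfl).differentiableAt one_ne_zero).hasFDerivAt
  have ha : ∀ a : E, HasFDerivAt (fun z ↦ fderiv ℝ G z a) ((fderiv ℝ (fderiv ℝ G) y).flip a) y := by
    intro a
    have := hP.clm_apply (hasFDerivAt_const a y)
    simpa only [ContinuousLinearMap.comp_zero, zero_add] using this
  have hB : HasFDerivAt (fun z ↦ h (G z)) ((fderiv ℝ h (G y)).comp (fderiv ℝ G y)) y :=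
    hh.hasFDerivAt.comp y hGd.hasFDerivAt
  have hM := hB.clm_apply (ha v)
  have hφ := hM.clm_apply (ha w)
  have heq : (fun z ↦ h' z v w) =ᶠ[𝓝 y] fun z ↦ h (G z) (fderiv ℝ G z v) (fderiv ℝ G z w) :=
    hlaw.mono fun z hz ↦ hz v w
  rw [← OpensChart.fderiv_apply₂ h' hh' v w u, heq.fderiv_eq, hφ.fderiv]
  simp only [_root_.add_apply, ContinuousLinearMap.comp_apply, ContinuousLinearMap.flip_apply]
  ring

/-! ### Radial integration -/

section Radial

variable {F : Type*} [NormedAddCommGroup F] [NormedSpace ℝ F]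

/-- **Radial integration of a derivative bound `‖Df(z)‖ ≤ C‖z‖^{−1−α}`.** If `f` is
differentiable on `{R ≤ ‖z‖}` (`R > 0`) with this bound (`α > 0`), then for `‖y‖ ≥ R` and
`t ≥ 1`, `‖f(t y) − f(y)‖ ≤ (C/α) ‖y‖^{−α}` (mean value inequality along the ray with the
boundary function `(C/α)‖y‖^{−α}(1 − s^{−α})`). Bartnik 1986, proof of Cor. 3.2 ("integrating
along rays"). [cite: Bartnik1986, §3, Cor. 3.2] -/
theorem norm_sub_smul_le_of_norm_fderiv_le {f : E → F} {R C α : ℝ} (hR : 0 < R) (hα : 0 < α)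
    (hC : 0 ≤ C) (hdiff : ∀ z : E, R ≤ ‖z‖ → DifferentiableAt ℝ f z)
    (hbound : ∀ z : E, R ≤ ‖z‖ → ‖fderiv ℝ f z‖ ≤ C * ‖z‖ ^ (-1 - α))
    {y : E} (hy : R ≤ ‖y‖) {t : ℝ} (ht : 1 ≤ t) :
    ‖f (t • y) - f y‖ ≤ C / α * ‖y‖ ^ (-α) := by
  have hy0 : 0 < ‖y‖ := hR.trans_le hy
  -- the path and its derivative
  set g : ℝ → F := fun s ↦ f (s • y) - f y with hg
  set g' : ℝ → F := fun s ↦ fderiv ℝ f (s • y) y with hg'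
  have hfar : ∀ s : ℝ, 1 ≤ s → R ≤ ‖s • y‖ := fun s hs ↦ by
    rw [norm_smul, Real.norm_of_nonneg (by linarith)]
    nlinarith
  have hderiv : ∀ s : ℝ, 1 ≤ s → HasDerivAt g (g' s) s := by
    intro s hs
    have h1 : HasDerivAt (fun s : ℝ ↦ s • y) y s := by
      simpa using (hasDerivAt_id s).smul_const y
    have h2 : HasFDerivAt f (fderiv ℝ f (s • y)) (s • y) := (hdiff _ (hfar s hs)).hasFDerivAt
    exact (h2.comp_hasDerivAt s h1).sub_const (f y)
  -- the boundary function
  set B : ℝ → ℝ := fun s ↦ C / α * ‖y‖ ^ (-α) * (1 - s ^ (-α)) with hBdef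
  set B' : ℝ → ℝ := fun s ↦ C * ‖y‖ ^ (-α) * s ^ (-1 - α) with hB'def
  have hBderiv : ∀ s : ℝ, 0 < s → HasDerivAt B (B' s) s := by
    intro s hs
    have h1 : HasDerivAt (fun s : ℝ ↦ s ^ (-α)) (-α * s ^ (-α - 1)) s := by
      simpa using Real.hasDerivAt_rpow_const (p := -α) (Or.inl hs.ne')
    refine (((hasDerivAt_const s (1 : ℝ)).fun_sub h1).const_mul (C / α * ‖y‖ ^ (-α))).congr_deriv ?_
    rw [hB'def]
    simp only
    rw [show (-1 - α) = (-α - 1) by ring]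
    field_simp
    ring
  have key := image_norm_le_of_norm_deriv_right_le_deriv_boundary' (f := g) (f' := g') (a := 1)
    (b := t) (B := B) (B' := B')
    (fun s hs ↦ (hderiv s hs.1).continuousAt.continuousWithinAt)
    (fun s hs ↦ (hderiv s hs.1).hasDerivWithinAt)
    (by simp [hg, hBdef])
    (fun s hs ↦ (hBderiv s (by linarith [hs.1])).continuousAt.continuousWithinAt)
    (fun s hs ↦ (hBderiv s (by linarith [hs.1])).hasDerivWithinAt)
    (fun s hs ↦ by
      have hs1 : 1 ≤ s := hs.1
      have hs0 : 0 < s := by linarith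
      rw [hg', hB'def]
      calc ‖fderiv ℝ f (s • y) y‖ ≤ ‖fderiv ℝ f (s • y)‖ * ‖y‖ := le_opNorm _ _
        _ ≤ C * ‖s • y‖ ^ (-1 - α) * ‖y‖ := by gcongr; exact hbound _ (hfar s hs1)
        _ = C * ‖y‖ ^ (-α) * s ^ (-1 - α) := by
            rw [norm_smul, Real.norm_of_nonneg hs0.le, Real.mul_rpow hs0.le hy0.le]
            have : ‖y‖ ^ (-1 - α) * ‖y‖ = ‖y‖ ^ (-α) := by
              rw [← Real.rpow_add_one hy0.ne']
              ring_nf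
            calc C * (s ^ (-1 - α) * ‖y‖ ^ (-1 - α)) * ‖y‖
                = C * s ^ (-1 - α) * (‖y‖ ^ (-1 - α) * ‖y‖) := by ring
              _ = C * ‖y‖ ^ (-α) * s ^ (-1 - α) := by rw [this]; ring)
    (right_mem_Icc.2 ht)
  have ht0 : 0 < t := by linarith
  calc ‖f (t • y) - f y‖ = ‖g t‖ := rfl
    _ ≤ B t := key
    _ = C / α * ‖y‖ ^ (-α) * (1 - t ^ (-α)) := rfl
    _ ≤ C / α * ‖y‖ ^ (-α) * 1 := by
        gcongr
        linarith [Real.rpow_nonneg ht0.le (-α)]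
    _ = C / α * ‖y‖ ^ (-α) := mul_one _

/-- **Limits along rays.** Under the same hypotheses, with `F` complete, `t ↦ f(t y)` converges as
`t → ∞` for every `‖y‖ ≥ R`, and the limit `L` satisfies `‖f(y) − L‖ ≤ (C/α)‖y‖^{−α}`. [folklore] -/
theorem exists_tendsto_ray [CompleteSpace F] {f : E → F} {R C α : ℝ} (hR : 0 < R) (hα : 0 < α)
    (hC : 0 ≤ C) (hdiff : ∀ z : E, R ≤ ‖z‖ → DifferentiableAt ℝ f z)
    (hbound : ∀ z : E, R ≤ ‖z‖ → ‖fderiv ℝ f z‖ ≤ C * ‖z‖ ^ (-1 - α))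
    {y : E} (hy : R ≤ ‖y‖) :
    ∃ L : F, Tendsto (fun t : ℝ ↦ f (t • y)) atTop (𝓝 L) ∧ ‖f y - L‖ ≤ C / α * ‖y‖ ^ (-α) := by
  have hy0 : 0 < ‖y‖ := hR.trans_le hy
  -- increments along the ray beyond parameter `t₁ ≥ 1`
  have hincr : ∀ t₁ t₂ : ℝ, 1 ≤ t₁ → t₁ ≤ t₂ →
      ‖f (t₂ • y) - f (t₁ • y)‖ ≤ C / α * (t₁ * ‖y‖) ^ (-α) := by
    intro t₁ t₂ ht₁ ht₁₂
    have ht₁0 : 0 < t₁ := by linarith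
    have hy₁ : R ≤ ‖t₁ • y‖ := by
      rw [norm_smul, Real.norm_of_nonneg ht₁0.le]; nlinarith
    have := norm_sub_smul_le_of_norm_fderiv_le hR hα hC hdiff hbound hy₁
      (t := t₂ / t₁) ((one_le_div ht₁0).2 ht₁₂)
    rwa [smul_smul, div_mul_cancel₀ _ ht₁0.ne', norm_smul, Real.norm_of_nonneg ht₁0.le] at this
  -- Cauchy
  have htend0 : Tendsto (fun t₁ : ℝ ↦ C / α * (t₁ * ‖y‖) ^ (-α)) atTop (𝓝 0) := by
    have h1 : Tendsto (fun t₁ : ℝ ↦ t₁ * ‖y‖) atTop atTop :=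
      tendsto_id.atTop_mul_const hy0
    have h2 := (tendsto_rpow_neg_atTop hα).comp h1
    simpa using h2.const_mul (C / α)
  have hCauchy : CauchySeq fun t : ℝ ↦ f (t • y) := by
    refine Metric.cauchySeq_iff'.2 fun ε hε ↦ ?_
    have hev := (htend0.eventually (gt_mem_nhds hε))
    obtain ⟨N, hN⟩ := eventually_atTop.1 hev
    refine ⟨max N 1, fun t ht ↦ ?_⟩
    rw [dist_eq_norm]
    calc ‖f (t • y) - f (max N 1 • y)‖ ≤ C / α * (max N 1 * ‖y‖) ^ (-α) :=
          hincr _ _ (le_max_right _ _) ht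
      _ < ε := hN _ (le_max_left _ _)
  obtain ⟨L, hL⟩ := cauchySeq_tendsto_of_complete hCauchy
  refine ⟨L, hL, ?_⟩
  -- pass to the limit in `‖f(t y) − f(y)‖ ≤ (C/α)‖y‖^{-α}`
  have hlim : Tendsto (fun t : ℝ ↦ ‖f y - f (t • y)‖) atTop (𝓝 ‖f y - L‖) :=
    (tendsto_const_nhds.sub hL).norm
  refine le_of_tendsto hlim ?_
  filter_upwards [eventually_ge_atTop (1 : ℝ)] with t ht
  rw [norm_sub_rev]
  exact norm_sub_smul_le_of_norm_fderiv_le hR hα hC hdiff hbound hy ht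

/-- **Chords away from the origin.** For `y₁`, `y₂` of the same norm `ρ` with `⟪y₁, y₂⟫ ≥ 0`,
every point of the segment `[y₁, y₂]` has norm at least `ρ/2` (indeed `ρ/√2`). [folklore] -/
theorem norm_ge_of_mem_segment {y₁ y₂ : E} {ρ : ℝ} (h₁ : ‖y₁‖ = ρ) (h₂ : ‖y₂‖ = ρ)
    (h12 : 0 ≤ ⟪y₁, y₂⟫) {z : E} (hz : z ∈ segment ℝ y₁ y₂) : ρ / 2 ≤ ‖z‖ := by
  obtain ⟨a, c, ha, hc, hac, rfl⟩ := hz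
  have hρ : 0 ≤ ρ := h₁ ▸ norm_nonneg y₁
  have hsq : ‖a • y₁ + c • y₂‖ ^ 2 = a ^ 2 * ρ ^ 2 + c ^ 2 * ρ ^ 2 + 2 * (a * c) * ⟪y₁, y₂⟫ := by
    rw [@norm_add_sq_real, norm_smul, norm_smul, Real.norm_of_nonneg ha, Real.norm_of_nonneg hc,
      h₁, h₂, real_inner_smul_left, real_inner_smul_right]
    ring
  have hlow : (ρ / 2) ^ 2 ≤ ‖a • y₁ + c • y₂‖ ^ 2 := by
    rw [hsq]
    have hc' : c = 1 - a := by linarith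
    subst hc'
    nlinarith [mul_nonneg (mul_nonneg ha hc) h12, sq_nonneg (a - 1 / 2), sq_nonneg ρ]
  exact (pow_le_pow_iff_left₀ (by positivity) (norm_nonneg _) two_ne_zero).1 hlow

/-- **Limits along different rays agree** when the rays make an acute angle: with the derivative
bound `‖Df(z)‖ ≤ C‖z‖^{−1−α}` on `{R ≤ ‖z‖}`, for `‖y₁‖ = ‖y₂‖ = ρ ≥ 2R` and `⟪y₁, y₂⟫ ≥ 0`,
`‖f(t y₂) − f(t y₁)‖ → 0` (mean value inequality on the chord, which stays in `{‖z‖ ≥ tρ/2}`).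
[folklore] -/
theorem tendsto_sub_ray_of_inner_nonneg {f : E → F} {R C α : ℝ} (hR : 0 < R) (hα : 0 < α)
    (hC : 0 ≤ C) (hdiff : ∀ z : E, R ≤ ‖z‖ → DifferentiableAt ℝ f z)
    (hbound : ∀ z : E, R ≤ ‖z‖ → ‖fderiv ℝ f z‖ ≤ C * ‖z‖ ^ (-1 - α))
    {y₁ y₂ : E} {ρ : ℝ} (hρ : 2 * R ≤ ρ) (h₁ : ‖y₁‖ = ρ) (h₂ : ‖y₂‖ = ρ) (h12 : 0 ≤ ⟪y₁, y₂⟫) :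
    Tendsto (fun t : ℝ ↦ f (t • y₂) - f (t • y₁)) atTop (𝓝 0) := by
  have hρ0 : 0 < ρ := by linarith
  -- the bound on the chord at parameter `t ≥ 1`
  have hchord : ∀ t : ℝ, 1 ≤ t →
      ‖f (t • y₂) - f (t • y₁)‖ ≤ C * (t * ρ / 2) ^ (-1 - α) * (2 * (t * ρ)) := by
    intro t ht
    have ht0 : 0 < t := by linarith
    have hn₁ : ‖t • y₁‖ = t * ρ := by rw [norm_smul, Real.norm_of_nonneg ht0.le, h₁]
    have hn₂ : ‖t • y₂‖ = t * ρ := by rw [norm_smul, Real.norm_of_nonneg ht0.le, h₂]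
    have hinner : 0 ≤ ⟪t • y₁, t • y₂⟫ := by
      rw [real_inner_smul_left, real_inner_smul_right]; positivity
    have hseg : ∀ z ∈ segment ℝ (t • y₁) (t • y₂), t * ρ / 2 ≤ ‖z‖ := fun z hz ↦
      norm_ge_of_mem_segment hn₁ hn₂ hinner hz
    have hfarz : ∀ z ∈ segment ℝ (t • y₁) (t • y₂), R ≤ ‖z‖ := fun z hz ↦ by
      have := hseg z hz; nlinarith
    have hmvt := Convex.norm_image_sub_le_of_norm_fderiv_le (𝕜 := ℝ) (f := f)
      (s := segment ℝ (t • y₁) (t • y₂)) (C := C * (t * ρ / 2) ^ (-1 - α))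
      (fun z hz ↦ hdiff z (hfarz z hz))
      (fun z hz ↦ by
        have hz := hseg z hz
        have hz0 : 0 < t * ρ / 2 := by positivity
        calc ‖fderiv ℝ f z‖ ≤ C * ‖z‖ ^ (-1 - α) := hbound z (hfarz z ‹_›)
          _ ≤ C * (t * ρ / 2) ^ (-1 - α) :=
              mul_le_mul_of_nonneg_left (Real.rpow_le_rpow_of_nonpos hz0 hz (by linarith)) hC)
      (convex_segment _ _) (left_mem_segment _ _ _) (right_mem_segment _ _ _)
    refine hmvt.trans ?_
    gcongr
    calc ‖t • y₂ - t • y₁‖ ≤ ‖t • y₂‖ + ‖t • y₁‖ := norm_sub_le _ _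
      _ = 2 * (t * ρ) := by rw [hn₁, hn₂]; ring
  -- which tends to zero
  have hlim : Tendsto (fun t : ℝ ↦ C * (t * ρ / 2) ^ (-1 - α) * (2 * (t * ρ))) atTop (𝓝 0) := by
    have heq : ∀ t : ℝ, 0 < t →
        C * (t * ρ / 2) ^ (-1 - α) * (2 * (t * ρ)) = (4 * C * (ρ / 2) ^ (-α)) * t ^ (-α) := by
      intro t ht
      have h2 : (0 : ℝ) < ρ / 2 := by positivity
      rw [show t * ρ / 2 = t * (ρ / 2) by ring, Real.mul_rpow ht.le h2.le,
        show (-1 - α) = (-α) + (-1 : ℝ) by ring, Real.rpow_add ht, Real.rpow_add h2,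
        Real.rpow_neg_one, Real.rpow_neg_one]
      field_simp
      ring
    have h1 : Tendsto (fun t : ℝ ↦ (4 * C * (ρ / 2) ^ (-α)) * t ^ (-α)) atTop (𝓝 0) := by
      simpa using (tendsto_rpow_neg_atTop hα).const_mul (4 * C * (ρ / 2) ^ (-α))
    refine h1.congr' ?_
    filter_upwards [eventually_gt_atTop (0 : ℝ)] with t ht
    exact (heq t ht).symm
  refine squeeze_zero_norm' ?_ hlim
  filter_upwards [eventually_ge_atTop (1 : ℝ)] with t ht
  exact hchord t ht

/-- **A map with `‖Df(z)‖ ≤ C‖z‖^{−1−α}` at infinity has a limit at infinity, with rate.** On a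
real inner product space of dimension `≥ 2`: if `f` is differentiable on `{R ≤ ‖z‖}` (`R > 0`)
with `‖Df(z)‖ ≤ C‖z‖^{−1−α}` (`α > 0`), then there is `L` with `‖f(y) − L‖ ≤ (C/α)‖y‖^{−α}` for
all `‖y‖ ≥ 2R` (limits along rays exist and agree: acute rays by the chord estimate, any two rays
through an intermediate one). Applied to `f = DG` this is the existence of the asymptotic rotation
`O` of Bartnik 1986, Cor. 3.2. [cite: Bartnik1986, §3, Cor. 3.2] -/
theorem exists_limit_of_norm_fderiv_le [CompleteSpace F] (h2 : 2 ≤ Module.finrank ℝ E)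
    {f : E → F} {R C α : ℝ} (hR : 0 < R) (hα : 0 < α) (hC : 0 ≤ C)
    (hdiff : ∀ z : E, R ≤ ‖z‖ → DifferentiableAt ℝ f z)
    (hbound : ∀ z : E, R ≤ ‖z‖ → ‖fderiv ℝ f z‖ ≤ C * ‖z‖ ^ (-1 - α)) :
    ∃ L : F, ∀ y : E, 2 * R ≤ ‖y‖ → ‖f y - L‖ ≤ C / α * ‖y‖ ^ (-α) := by
  classical
  haveI : FiniteDimensional ℝ E := Module.finite_of_finrank_pos (by omega)
  -- the limit along the ray through `y`
  have hray := fun (y : E) (hy : R ≤ ‖y‖) ↦ exists_tendsto_ray hR hα hC hdiff hbound hy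
  choose! L hL hLrate using hray
  -- rays of norm `2R`
  set ρ : ℝ := 2 * R with hρ
  have hρR : R ≤ ρ := by linarith
  have hρ0 : 0 < ρ := by linarith
  -- (a) acute rays have the same limit
  have hacute : ∀ y₁ y₂ : E, ‖y₁‖ = ρ → ‖y₂‖ = ρ → 0 ≤ ⟪y₁, y₂⟫ → L y₁ = L y₂ := by
    intro y₁ y₂ h₁ h₂ h12
    have t1 := hL y₁ (by rw [h₁]; exact hρR)
    have t2 := hL y₂ (by rw [h₂]; exact hρR)
    have t3 := tendsto_sub_ray_of_inner_nonneg hR hα hC hdiff hbound le_rfl h₁ h₂ h12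
    have : Tendsto (fun t : ℝ ↦ f (t • y₂) - f (t • y₁)) atTop (𝓝 (L y₂ - L y₁)) := t2.sub t1
    have := tendsto_nhds_unique this t3
    exact (sub_eq_zero.1 this).symm
  -- (b) any two rays of norm `ρ` have the same limit
  have hall : ∀ y₁ y₂ : E, ‖y₁‖ = ρ → ‖y₂‖ = ρ → L y₁ = L y₂ := by
    intro y₁ y₂ h₁ h₂
    by_cases h12 : 0 ≤ ⟪y₁, y₂⟫
    · exact hacute y₁ y₂ h₁ h₂ h12
    push Not at h12
    by_cases hsum : y₁ + y₂ = 0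
    · -- antipodal: go through a vector orthogonal to `y₁`
      have hy₁0 : y₁ ≠ 0 := by
        intro h0; rw [h0, norm_zero] at h₁; linarith
      have hK : 0 < Module.finrank ℝ (ℝ ∙ y₁)ᗮ := by
        have hsum' := Submodule.finrank_add_finrank_orthogonal (ℝ ∙ y₁)
        rw [finrank_span_singleton hy₁0] at hsum'
        omega
      obtain ⟨⟨z, hzK⟩, hz0⟩ := Module.finrank_pos_iff_exists_ne_zero.1 hK
      have hz0' : z ≠ 0 := fun h0 ↦ hz0 (Subtype.ext h0)
      have hzy : ⟪y₁, z⟫ = 0 := by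
        rw [Submodule.mem_orthogonal_singleton_iff_inner_right] at hzK
        exact hzK
      set y₃ : E := (ρ / ‖z‖) • z with hy₃
      have hzn : 0 < ‖z‖ := norm_pos_iff.2 hz0'
      have h₃ : ‖y₃‖ = ρ := by
        rw [hy₃, norm_smul, Real.norm_of_nonneg (by positivity), div_mul_cancel₀ _ hzn.ne']
      have h13 : 0 ≤ ⟪y₁, y₃⟫ := by
        rw [hy₃, real_inner_smul_right, hzy, mul_zero]
      have hy₂ : y₂ = -y₁ := by rw [← sub_eq_zero, sub_neg_eq_add, add_comm]; exact hsum
      have h32 : 0 ≤ ⟪y₃, y₂⟫ := by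
        rw [hy₂, inner_neg_right, real_inner_comm, hy₃, real_inner_smul_right, hzy, mul_zero,
          neg_zero]
      exact (hacute y₁ y₃ h₁ h₃ h13).trans (hacute y₃ y₂ h₃ h₂ h32)
    · -- through the bisector
      set y₃ : E := (ρ / ‖y₁ + y₂‖) • (y₁ + y₂) with hy₃
      have hn : 0 < ‖y₁ + y₂‖ := norm_pos_iff.2 hsum
      have h₃ : ‖y₃‖ = ρ := by
        rw [hy₃, norm_smul, Real.norm_of_nonneg (by positivity), div_mul_cancel₀ _ hn.ne']
      have hcs : |⟪y₁, y₂⟫| ≤ ρ * ρ := by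
        have := abs_real_inner_le_norm y₁ y₂
        rwa [h₁, h₂] at this
      have h13 : 0 ≤ ⟪y₁, y₃⟫ := by
        rw [hy₃, real_inner_smul_right, inner_add_right, real_inner_self_eq_norm_sq, h₁]
        refine mul_nonneg (by positivity) ?_
        nlinarith [abs_le.1 hcs]
      have h32 : 0 ≤ ⟪y₃, y₂⟫ := by
        rw [hy₃, real_inner_smul_left, inner_add_left, real_inner_self_eq_norm_sq, h₂]
        refine mul_nonneg (by positivity) ?_
        nlinarith [abs_le.1 hcs]
      exact (hacute y₁ y₃ h₁ h₃ h13).trans (hacute y₃ y₂ h₃ h₂ h32)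
  -- (c) the limit along the ray through `y` is that through `(ρ/‖y‖) y`
  have hscale : ∀ y : E, ρ ≤ ‖y‖ → L y = L ((ρ / ‖y‖) • y) := by
    intro y hy
    have hy0 : 0 < ‖y‖ := by linarith
    have hc : 0 < ρ / ‖y‖ := by positivity
    have t1 := hL y (hρR.trans hy)
    have hn : ‖(ρ / ‖y‖) • y‖ = ρ := by
      rw [norm_smul, Real.norm_of_nonneg hc.le, div_mul_cancel₀ _ hy0.ne']
    have t2 := hL ((ρ / ‖y‖) • y) (by rw [hn]; exact hρR)
    -- `t ↦ f (t • (c • y))` is `f ((t c) • y)`, a reparametrisation of the first ray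
    have t2' : Tendsto (fun t : ℝ ↦ f ((t * (ρ / ‖y‖)) • y)) atTop (𝓝 (L ((ρ / ‖y‖) • y))) := by
      simpa only [smul_smul] using t2
    have t1' : Tendsto (fun t : ℝ ↦ f ((t * (ρ / ‖y‖)) • y)) atTop (𝓝 (L y)) :=
      t1.comp (tendsto_id.atTop_mul_const hc)
    exact tendsto_nhds_unique t1' t2'
  -- conclusion with the common limit
  obtain ⟨y₀, hy₀⟩ : ∃ y₀ : E, ‖y₀‖ = ρ := by
    haveI : Nontrivial E := Module.nontrivial_of_finrank_pos (R := ℝ) (by omega)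
    obtain ⟨z, hz⟩ := exists_ne (0 : E)
    have hzn : 0 < ‖z‖ := norm_pos_iff.2 hz
    exact ⟨(ρ / ‖z‖) • z, by
      rw [norm_smul, Real.norm_of_nonneg (by positivity), div_mul_cancel₀ _ hzn.ne']⟩
  refine ⟨L y₀, fun y hy ↦ ?_⟩
  have hy0 : 0 < ‖y‖ := by linarith
  have hn : ‖(ρ / ‖y‖) • y‖ = ρ := by
    rw [norm_smul, Real.norm_of_nonneg (by positivity), div_mul_cancel₀ _ hy0.ne']
  rw [← hall _ _ hn hy₀, ← hscale y hy]
  exact hLrate y (hρR.trans hy)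

/-- **Growth from a derivative bound `‖Df(z)‖ ≤ C‖z‖^{−α}`, `α < 1`.** If `f` is
differentiable on `{R ≤ ‖z‖}` (`R > 0`, `E` finite-dimensional) with this bound, then there is
`M` with `‖f(y)‖ ≤ M + (C/(1−α)) ‖y‖^{1−α}` for all `‖y‖ ≥ R` (integrate along the ray from the
sphere of radius `R`, on which `f` is bounded). For `α = 0` this is linear growth of the
transition map, for `0 < α < 1` the sublinear growth of `G − O`; Bartnik 1986, Cor. 3.2
(`x − y ∈ W^{2,q}_{1−τ}`). [cite: Bartnik1986, §3, Cor. 3.2] -/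
theorem norm_le_of_norm_fderiv_le_rpow [FiniteDimensional ℝ E] {f : E → F} {R C α : ℝ}
    (hR : 0 < R) (hα1 : α < 1) (hC : 0 ≤ C)
    (hdiff : ∀ z : E, R ≤ ‖z‖ → DifferentiableAt ℝ f z)
    (hbound : ∀ z : E, R ≤ ‖z‖ → ‖fderiv ℝ f z‖ ≤ C * ‖z‖ ^ (-α)) :
    ∃ M : ℝ, ∀ y : E, R ≤ ‖y‖ → ‖f y‖ ≤ M + C / (1 - α) * ‖y‖ ^ (1 - α) := by
  -- `f` is bounded on the sphere of radius `R`
  have hcont : ContinuousOn f (sphere (0 : E) R) := fun z hz ↦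
    (hdiff z (by rw [mem_sphere_zero_iff_norm.1 hz])).continuousAt.continuousWithinAt
  obtain ⟨M, hM⟩ := (isCompact_sphere (0 : E) R).exists_bound_of_continuousOn hcont
  refine ⟨M, fun y hy ↦ ?_⟩
  have hy0 : 0 < ‖y‖ := hR.trans_le hy
  have h1α : 0 < 1 - α := by linarith
  -- the ray `s ↦ s • y`, `s ∈ [R/‖y‖, 1]`
  set s₀ : ℝ := R / ‖y‖ with hs₀
  have hs₀0 : 0 < s₀ := by positivity
  have hs₀1 : s₀ ≤ 1 := (div_le_one hy0).2 hy
  have hfar : ∀ s : ℝ, s₀ ≤ s → R ≤ ‖s • y‖ := fun s hs ↦ by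
    rw [norm_smul, Real.norm_of_nonneg (hs₀0.le.trans hs)]
    calc R = s₀ * ‖y‖ := by rw [hs₀, div_mul_cancel₀ _ hy0.ne']
      _ ≤ s * ‖y‖ := by gcongr
  set g : ℝ → F := fun s ↦ f (s • y) with hg
  set g' : ℝ → F := fun s ↦ fderiv ℝ f (s • y) y with hg'
  have hderiv : ∀ s : ℝ, s₀ ≤ s → HasDerivAt g (g' s) s := by
    intro s hs
    have h1 : HasDerivAt (fun s : ℝ ↦ s • y) y s := by
      simpa using (hasDerivAt_id s).smul_const y
    exact (hdiff _ (hfar s hs)).hasFDerivAt.comp_hasDerivAt s h1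
  set B : ℝ → ℝ := fun s ↦ M + C / (1 - α) * ‖y‖ ^ (1 - α) * (s ^ (1 - α) - s₀ ^ (1 - α))
    with hBdef
  set B' : ℝ → ℝ := fun s ↦ C * ‖y‖ ^ (1 - α) * s ^ (-α) with hB'def
  have hBderiv : ∀ s : ℝ, 0 < s → HasDerivAt B (B' s) s := by
    intro s hs
    have h1 : HasDerivAt (fun s : ℝ ↦ s ^ (1 - α)) ((1 - α) * s ^ (1 - α - 1)) s := by
      simpa using Real.hasDerivAt_rpow_const (p := 1 - α) (Or.inl hs.ne')
    refine (((h1.sub_const (s₀ ^ (1 - α))).const_mul (C / (1 - α) * ‖y‖ ^ (1 - α))).const_add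
      M).congr_deriv ?_
    rw [hB'def]
    simp only
    rw [show (1 - α - 1) = -α by ring]
    field_simp
  have key := image_norm_le_of_norm_deriv_right_le_deriv_boundary' (f := g) (f' := g') (a := s₀)
    (b := 1) (B := B) (B' := B')
    (fun s hs ↦ (hderiv s hs.1).continuousAt.continuousWithinAt)
    (fun s hs ↦ (hderiv s hs.1).hasDerivWithinAt)
    (by
      simp only [hg, hBdef, sub_self, mul_zero, add_zero]
      refine hM _ ?_
      rw [mem_sphere_zero_iff_norm, norm_smul, Real.norm_of_nonneg hs₀0.le, hs₀,
        div_mul_cancel₀ _ hy0.ne'])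
    (fun s hs ↦ (hBderiv s (hs₀0.trans_le hs.1)).continuousAt.continuousWithinAt)
    (fun s hs ↦ (hBderiv s (hs₀0.trans_le hs.1)).hasDerivWithinAt)
    (fun s hs ↦ by
      have hs0 : 0 < s := hs₀0.trans_le hs.1
      rw [hg', hB'def]
      calc ‖fderiv ℝ f (s • y) y‖ ≤ ‖fderiv ℝ f (s • y)‖ * ‖y‖ := le_opNorm _ _
        _ ≤ C * ‖s • y‖ ^ (-α) * ‖y‖ := by gcongr; exact hbound _ (hfar s hs.1)
        _ = C * ‖y‖ ^ (1 - α) * s ^ (-α) := by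
            rw [norm_smul, Real.norm_of_nonneg hs0.le, Real.mul_rpow hs0.le hy0.le]
            have : ‖y‖ ^ (-α) * ‖y‖ = ‖y‖ ^ (1 - α) := by
              rw [← Real.rpow_add_one hy0.ne']
              ring_nf
            calc C * (s ^ (-α) * ‖y‖ ^ (-α)) * ‖y‖ = C * s ^ (-α) * (‖y‖ ^ (-α) * ‖y‖) := by ring
              _ = C * ‖y‖ ^ (1 - α) * s ^ (-α) := by rw [this]; ring)
    (right_mem_Icc.2 hs₀1)
  calc ‖f y‖ = ‖g 1‖ := by simp [hg]
    _ ≤ B 1 := key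
    _ = M + C / (1 - α) * ‖y‖ ^ (1 - α) * (1 - s₀ ^ (1 - α)) := by
        simp [hBdef, Real.one_rpow]
    _ ≤ M + C / (1 - α) * ‖y‖ ^ (1 - α) * 1 := by
        gcongr
        linarith [Real.rpow_nonneg hs₀0.le (1 - α)]
    _ = M + C / (1 - α) * ‖y‖ ^ (1 - α) := by rw [mul_one]

end Radial

end TransitionRigidity

end Literature.Geometry.Lorentzian

end
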